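import Literature.Topology.FourManifolds.IsotopyExtensionHalfSpace
import Literature.Analysis.Calculus.WhitneyExtension
import Literature.Analysis.Calculus.WhitneyExtensionProofs
import HarnessLib

/-!
# The isotopy extension theorem for sources with arbitrary (convex) corners,
# modulo Whitney's extension theorem

Fact seat `provefact-Literature.isSmoothlyIsotopic_iff_isAmbientIsotopic` (`Isotopy.lean`).
The named facts `Literature.Topology.FourManifolds.isAmbientIsotopic_of_isSmoothlyIsotopic` and
`Literature.Topology.FourManifolds.isSmoothlyIsotopic_iff_isAmbientIsotopic` of `Isotopy.lean`
state Hirsch's isotopy extension theorem (*Differential Topology* (1976), Ch. 8 §1, Thm. 1.3)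
for a compact source `M` modelled on an **arbitrary** model with corners
`I : ModelWithCorners ℝ EM HM`, whereas Hirsch's `V` is a compact submanifold with (at most)
boundary (Ch. 1 §4).  The tree proves the facts for sources without boundary points
(`IsotopyExtensionBoundarylessManifold.lean`) and for sources modelled on the half-space
`𝓡∂ (m + 1)` (`IsotopyExtensionHalfSpace.lean`, Seeley's reflection across the boundary
hyperplane); in both, the only model-dependent input is the local extension of the velocity
field near a track point, reduced in
`Literature.Topology.FourManifolds.SmoothIsotopy.velocityExtendsLocallyNear_track_of_chartData`
to the extension of two chart expressions — `C^∞` *within* `ℝ × range I` on an open set of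
`ℝ × EM` — to `C^∞` maps on an open neighbourhood.  Over `ℝ` the range of a model with corners
is closed and convex with nonempty interior (`ModelWithCorners.isClosed_range`,
`ModelWithCorners.convex_range`, `ModelWithCorners.nonempty_interior`), so at a corner point this
is Whitney's extension theorem for `C^∞` functions on closed convex sets with nonempty interior
(Whitney (1934), Thm. I with §3), vendored as the named fact
`Literature.Analysis.Calculus.WhitneyExtensionConvex` (`WhitneyExtension.lean`).  This file
carries out the reduction:

* `Literature.Topology.FourManifolds.SmoothIsotopy.velocityExtendsLocallyNear_track_of_whitney`,
  `Literature.Topology.FourManifolds.SmoothIsotopy.velocityExtendsLocally_of_whitney` — for any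
  model `I` (finite-dimensional `EM`), Whitney's theorem supplies the chart data of
  `velocityExtendsLocallyNear_track_of_chartData` at every track point;
* `Literature.Topology.FourManifolds.SmoothIsotopy.exists_ambientIsotopy_comp_eq_of_whitney` —
  Thm. 1.3 as printed ("`F` extends to a diffeotopy"): an ambient isotopy `Ψ` of the closed
  target with `Ψ_t ∘ F_0 = F_t`, `t ∈ [0, 1]`, for a compact source over any model;
* `Literature.Topology.FourManifolds.isAmbientIsotopic_of_isSmoothlyIsotopic_of_whitney`,
  `Literature.Topology.FourManifolds.isSmoothlyIsotopic_iff_isAmbientIsotopic_of_whitney` —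
  **the named facts of `Isotopy.lean` in full generality, from `WhitneyExtensionConvex`**
  (the model vector spaces are finite-dimensional automatically,
  `Manifold.finiteDimensional_of_compactSpace`).

So `isSmoothlyIsotopic_iff_isAmbientIsotopic` holds unconditionally for sources that are
manifolds without boundary points or half-space manifolds with boundary (the cases of the
source), and in general it is reduced to Whitney's theorem — which is now **proved** in the
tree (`Literature.Analysis.Calculus.WhitneyExtensionConvex_holds`, `WhitneyExtensionProofs.lean`,
by a dilation–extrapolation extension operator on convex bodies), whence the **unconditional
discharges** at the end of this file:

* `Literature.Topology.FourManifolds.isAmbientIsotopic_of_isSmoothlyIsotopic_holds`,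
  `Literature.Topology.FourManifolds.isSmoothlyIsotopic_iff_isAmbientIsotopic_holds` — the named
  facts of `Isotopy.lean`, for compact sources over an arbitrary model with corners;
* `Literature.Topology.FourManifolds.SmoothIsotopy.exists_ambientIsotopy_comp_eq_holds` —
  Thm. 1.3 as printed, unconditionally.

## References

* M. W. Hirsch, *Differential Topology*, GTM 33, Springer (1976), Ch. 8 §1, Thm. 1.3 and its
  proof, pp. 179–180. [HirschDT1976]
* H. Whitney, *Analytic extensions of differentiable functions defined in closed sets*, Trans.
  Amer. Math. Soc. 36 (1934), 63–89, Thm. I and §3. [Whitney1934]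
-/

open scoped Manifold ContDiff Topology
open Set Function Filter

noncomputable section

namespace Literature.Topology.FourManifolds

open Literature.Analysis.Calculus

namespace SmoothIsotopy

variable {EM HM EN HN : Type*} [NormedAddCommGroup EM] [NormedSpace ℝ EM] [TopologicalSpace HM]
  [NormedAddCommGroup EN] [NormedSpace ℝ EN] [TopologicalSpace HN]
  {I : ModelWithCorners ℝ EM HM} {J : ModelWithCorners ℝ EN HN}
  {M : Type*} [TopologicalSpace M] [ChartedSpace HM M]
  {N : Type*} [TopologicalSpace N] [ChartedSpace HN N]
  {f g : M → N} (F : SmoothIsotopy I J f g)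

/-- The preimage of an open set of `N` under `(s, u) ↦ F_s (φ⁻¹ u)`, `u` ranging over the open
set `I⁻¹' φ.target` of the model vector space (on which `φ⁻¹ ∘ I⁻¹` is continuous, the inverse
of a model with corners being continuous on the whole model vector space), is open; any model
`I` (cf. `isOpen_preimage_stage_comp_extend_symm`, the half-space case). [folklore] -/
theorem isOpen_setOf_stage_extend_symm_mem (φ : OpenPartialHomeomorph M HM) {S : Set N}
    (hS : IsOpen S) :
    IsOpen {p : ℝ × EM | p.2 ∈ I.symm ⁻¹' φ.target ∧ F.toFun p.1 ((φ.extend I).symm p.2) ∈ S} := by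
  have hc : ContinuousOn (fun p : ℝ × EM => F.toFun p.1 ((φ.extend I).symm p.2))
      ((univ : Set ℝ) ×ˢ (I.symm ⁻¹' φ.target)) := by
    refine F.contMDiff.continuous.comp_continuousOn (continuousOn_fst.prodMk ?_)
    have h1 : ContinuousOn (φ.extend I).symm (I.symm ⁻¹' φ.target) := by
      rw [φ.extend_coe_symm]
      exact φ.continuousOn_symm.comp I.continuous_symm.continuousOn fun u hu => hu
    exact h1.comp continuousOn_snd fun p hp => hp.2
  have h := hc.isOpen_inter_preimage
    (isOpen_univ.prod (φ.open_target.preimage I.continuous_symm)) hS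
  convert h using 1
  ext p
  simp only [mem_setOf_eq, mem_inter_iff, mem_prod, mem_univ, true_and, mem_preimage]

omit [ChartedSpace HM M] in
/-- A chart value `u ∈ range I` over the open set `I⁻¹' φ.target` lies in the target of the
extended chart (`OpenPartialHomeomorph.extend_target`). [folklore] -/
theorem _root_.Literature.Topology.FourManifolds.mem_extend_target_of_mem_range
    (φ : OpenPartialHomeomorph M HM) {u : EM} (hu : u ∈ I.symm ⁻¹' φ.target)
    (hur : u ∈ range I) : u ∈ (φ.extend I).target := by
  rw [φ.extend_target]
  exact ⟨hu, hur⟩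

/-- **The velocity field extends near every track point of an isotopy of a compact manifold
with arbitrary corners, given Whitney's extension theorem.**  At a track point
`(t₀, F_{t₀} x₀)`, the chart expression `ψ (F_s (φ⁻¹ u))` of the track in immersion charts of
the stage `F_{t₀}` at `x₀` and the coordinates of the velocity in the trivialization of `TN` at
`F_{t₀} x₀` are `C^∞` *within* the closed convex set `ℝ × range I ⊆ ℝ × EM` (nonempty interior)
on open sets, hence agree near `(t₀, φ x₀)` with `C^∞` maps on open neighbourhoods by Whitney's
theorem (`WhitneyExtensionConvex.exists_contDiffOn_extension`), and
`velocityExtendsLocallyNear_track_of_chartData` applies.  For interior points this reproves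
`velocityExtendsLocallyNear_track_of_isInteriorPoint`, for half-space boundary points
`velocityExtendsLocallyNear_track_halfSpace` (there via Seeley's theorem, unconditionally).
Hirsch (1976), Ch. 8 §1, proof of Thm. 1.3 (extension of the field near the track).
[cite: HirschDT1976, Ch. 8 §1, proof of Thm. 1.3] -/
theorem velocityExtendsLocallyNear_track_of_whitney (hW : WhitneyExtensionConvex)
    [IsManifold I ∞ M] [CompactSpace M] [IsManifold J ∞ N] [T2Space N]
    [FiniteDimensional ℝ EM] [FiniteDimensional ℝ EN] {ρ : ℝ → ℝ} (hρ : ContDiff ℝ ∞ ρ)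
    (t₀ : ℝ) (x₀ : M) : F.VelocityExtendsLocallyNear ρ (F.track (t₀, x₀)) := by
  haveI : CompleteSpace EN := FiniteDimensional.complete ℝ EN
  -- immersion charts for the stage `F_{t₀}` at `x₀`
  have himm : Manifold.IsImmersionAt I J ∞ (F.toFun t₀) x₀ :=
    (F.isSmoothEmbedding t₀).isImmersion.isImmersionAt x₀
  set φ := himm.domChart with hφ_def
  set ψ := himm.codChart with hψ_def
  set e := himm.equiv with he_def
  have hφ : φ ∈ IsManifold.maximalAtlas I ∞ M := himm.domChart_mem_maximalAtlas
  have hψ : ψ ∈ IsManifold.maximalAtlas J ∞ N := himm.codChart_mem_maximalAtlas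
  have hxφ : x₀ ∈ φ.source := himm.mem_domChart_source
  have hyψ : F.toFun t₀ x₀ ∈ ψ.source := himm.mem_codChart_source
  have hwr : EqOn (ψ.extend J ∘ F.toFun t₀ ∘ (φ.extend I).symm)
      (e ∘ fun u => (u, (0 : himm.complement))) (φ.extend I).target :=
    himm.writtenInCharts
  -- the closed convex set `ℝ × range I ⊆ ℝ × EM`, of nonempty interior
  set C : Set (ℝ × EM) := (univ : Set ℝ) ×ˢ range I with hC
  have hCcl : IsClosed C := isClosed_univ.prod I.isClosed_range
  have hCc : Convex ℝ C := convex_univ.prod I.convex_range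
  have hCi : (interior C).Nonempty := by
    rw [hC, interior_prod_eq, interior_univ]
    exact univ_nonempty.prod I.nonempty_interior
  have hCmem : ∀ p : ℝ × EM, p ∈ C ↔ p.2 ∈ range I := fun p =>
    ⟨fun h => h.2, fun h => ⟨mem_univ _, h⟩⟩
  -- the chart value of `x₀`
  set u₀ : EM := φ.extend I x₀ with hu₀
  have hu₀T : u₀ ∈ (φ.extend I).target :=
    (φ.extend I).map_source (by rwa [φ.extend_source])
  have hu₀φ : u₀ ∈ I.symm ⁻¹' φ.target := by
    have h := hu₀T
    rw [φ.extend_target] at h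
    exact h.1
  have hu₀r : u₀ ∈ range I := by
    have h := hu₀T
    rw [φ.extend_target] at h
    exact h.2
  have hp₀C : ((t₀, u₀) : ℝ × EM) ∈ C := ⟨mem_univ _, hu₀r⟩
  have hsymm₀ : (φ.extend I).symm u₀ = x₀ := φ.extend_left_inv hxφ
  -- (a) Whitney extension of the chart expression of the track
  set O₁ : Set (ℝ × EM) := {p | p.2 ∈ I.symm ⁻¹' φ.target ∧
    F.toFun p.1 ((φ.extend I).symm p.2) ∈ ψ.source} with hO₁
  have hO₁o : IsOpen O₁ := F.isOpen_setOf_stage_extend_symm_mem φ ψ.open_source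
  have hp₀O₁ : (t₀, u₀) ∈ O₁ := ⟨hu₀φ, by simpa only [hsymm₀] using hyψ⟩
  have hk₁ : ContDiffOn ℝ ∞ (F.trackChart φ ψ) (O₁ ∩ C) :=
    (F.contDiffOn_trackChart' φ ψ hφ hψ).mono fun p hp =>
      ⟨mem_extend_target_of_mem_range φ hp.1.1 ((hCmem p).1 hp.2), hp.1.2⟩
  obtain ⟨O, hOo, hp₀O, -, k, hk, hkeq⟩ :=
    hW.exists_contDiffOn_extension hCcl hCc hCi hO₁o hp₀O₁ hp₀C hk₁
  have hagree : ∀ p ∈ O, p.2 ∈ (φ.extend I).target →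
      F.toFun p.1 ((φ.extend I).symm p.2) ∈ ψ.source → k p = F.trackChart φ ψ p := by
    intro p hp hpT _
    refine hkeq ⟨hp, (hCmem p).2 ?_⟩
    rw [φ.extend_target] at hpT
    exact hpT.2
  -- (b) Whitney extension of the coordinates of the velocity
  set y₀ : N := F.toFun t₀ x₀ with hy₀
  set eN := trivializationAt EN (TangentSpace J) y₀ with heN
  set Vc : ℝ × EM → EN := fun p =>
    (eN ⟨F.toFun p.1 ((φ.extend I).symm p.2), F.velocity (p.1, (φ.extend I).symm p.2)⟩).2
    with hVc
  set O₂ : Set (ℝ × EM) := {p | p.2 ∈ I.symm ⁻¹' φ.target ∧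
    F.toFun p.1 ((φ.extend I).symm p.2) ∈ (chartAt HN y₀).source} with hO₂
  have hO₂o : IsOpen O₂ := F.isOpen_setOf_stage_extend_symm_mem φ (chartAt HN y₀).open_source
  have hp₀O₂ : (t₀, u₀) ∈ O₂ := ⟨hu₀φ, by
    show F.toFun t₀ ((φ.extend I).symm u₀) ∈ (chartAt HN y₀).source
    rw [hsymm₀]
    exact mem_chart_source HN y₀⟩
  have hVc₁ : ContDiffOn ℝ ∞ Vc (O₂ ∩ C) := by
    -- the velocity coordinates on `ℝ × M` near `(t₀, x₀)`
    set Q₀ : Set (ℝ × M) := {q | F.toFun q.1 q.2 ∈ (chartAt HN y₀).source} with hQ₀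
    have hmaps : MapsTo (fun q : ℝ × M => (⟨F.toFun q.1 q.2, F.velocity q⟩ : TangentBundle J N))
        Q₀ eN.source := by
      intro q hq
      rw [eN.mem_source, heN, TangentBundle.trivializationAt_baseSet]
      exact hq
    have hWv : ContMDiffOn (𝓘(ℝ, ℝ).prod I) 𝓘(ℝ, EN) ∞
        (fun q : ℝ × M => (eN ⟨F.toFun q.1 q.2, F.velocity q⟩).2) Q₀ :=
      ((eN.contMDiffOn_iff hmaps).1 F.contMDiff_velocity.contMDiffOn).2
    -- composed with `(s, u) ↦ (s, φ⁻¹ u)`, smooth within the chart target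
    have h1 : ContMDiffOn 𝓘(ℝ, ℝ × EM) (𝓘(ℝ, ℝ).prod I) ∞
        (fun p : ℝ × EM => ((p.1, (φ.extend I).symm p.2) : ℝ × M)) (O₂ ∩ C) := by
      refine (contDiff_fst.contMDiff.contMDiffOn).prodMk ?_
      refine (contMDiffOn_extend_symm hφ).comp contDiff_snd.contMDiff.contMDiffOn fun p hp => ?_
      rw [← φ.extend_target']
      exact mem_extend_target_of_mem_range φ hp.1.1 ((hCmem p).1 hp.2)
    have h2 := hWv.comp h1 fun p hp => hp.1.2
    exact contMDiffOn_iff_contDiffOn.1 h2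
  obtain ⟨O', hO'o, hp₀O', -, V, hV, hVeq⟩ :=
    hW.exists_contDiffOn_extension hCcl hCc hCi hO₂o hp₀O₂ hp₀C hVc₁
  have hVagree : ∀ p ∈ O', p.2 ∈ (φ.extend I).target →
      F.toFun p.1 ((φ.extend I).symm p.2) ∈ (chartAt HN (F.toFun t₀ x₀)).source →
      V p = (trivializationAt EN (TangentSpace J) (F.toFun t₀ x₀)
        ⟨F.toFun p.1 ((φ.extend I).symm p.2), F.velocity (p.1, (φ.extend I).symm p.2)⟩).2 := by
    intro p hp hpT _
    refine hVeq ⟨hp, (hCmem p).2 ?_⟩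
    rw [φ.extend_target] at hpT
    exact hpT.2
  exact F.velocityExtendsLocallyNear_track_of_chartData hρ φ ψ e hψ hxφ hyψ hwr hOo hp₀O hk
    hagree hO'o hp₀O' hV hVagree

/-- **Compact sources over any model with corners have the local extension property, given
Whitney's extension theorem.** [cite: HirschDT1976, Ch. 8 §1, proof of Thm. 1.3] -/
theorem velocityExtendsLocally_of_whitney (hW : WhitneyExtensionConvex) [IsManifold I ∞ M]
    [CompactSpace M] [IsManifold J ∞ N] [T2Space N] [FiniteDimensional ℝ EM]
    [FiniteDimensional ℝ EN] {ρ : ℝ → ℝ} (hρ : ContDiff ℝ ∞ ρ) :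
    F.VelocityExtendsLocally ρ :=
  F.velocityExtendsLocally_of_forall_track fun q =>
    F.velocityExtendsLocallyNear_track_of_whitney hW hρ q.1 q.2

/-- **Thm. 1.3 as printed, for compact sources over any model with corners, given Whitney's
extension theorem**: a smooth isotopy `F` of a compact manifold `M` (any model with corners)
in a closed manifold `N` (compact, Hausdorff, without boundary points) is covered by an ambient
isotopy `Ψ` of `N`, `Ψ_t ∘ F_0 = F_t` for `t ∈ [0, 1]` (indeed for `-1/2 < t < 3/2`) — "`F`
extends to a diffeotopy of `M`".  Unconditional special cases:
`exists_ambientIsotopy_comp_eq_of_velocityExtendsLocally` with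
`velocityExtendsLocally_of_boundarylessManifold` / `velocityExtendsLocally_halfSpace`.
[cite: HirschDT1976, Ch. 8 §1, Thm. 1.3] -/
theorem exists_ambientIsotopy_comp_eq_of_whitney (hW : WhitneyExtensionConvex)
    [IsManifold I ∞ M] [CompactSpace M] [IsManifold J ∞ N] [T2Space N] [CompactSpace N]
    [BoundarylessManifold J N] :
    ∃ Ψ : AmbientIsotopy J N, ∀ t ∈ Ioo (-1 / 2 : ℝ) (3 / 2), ∀ x,
      Ψ.toFun t (F.toFun 0 x) = F.toFun t x := by
  cases isEmpty_or_nonempty M with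
  | inl hM =>
    exact ⟨.refl, fun t _ x => (IsEmpty.false x).elim⟩
  | inr hM =>
    haveI : Nonempty N := ⟨F.toFun 0 (Classical.arbitrary M)⟩
    haveI : FiniteDimensional ℝ EN := Manifold.finiteDimensional_of_compactSpace J N
    haveI : FiniteDimensional ℝ EM := Manifold.finiteDimensional_of_compactSpace I M
    exact F.exists_ambientIsotopy_comp_eq_of_velocityExtendsLocally
      (F.velocityExtendsLocally_of_whitney hW contDiff_timeCutoff)

end SmoothIsotopy

/-! ### The named facts of `Isotopy.lean`, from Whitney's extension theorem -/

section Facts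

variable {EM HM EN HN : Type*} [NormedAddCommGroup EM] [NormedSpace ℝ EM] [TopologicalSpace HM]
  [NormedAddCommGroup EN] [NormedSpace ℝ EN] [TopologicalSpace HN]
  {I : ModelWithCorners ℝ EM HM} {J : ModelWithCorners ℝ EN HN}
  {M : Type*} [TopologicalSpace M] [ChartedSpace HM M]
  {N : Type*} [TopologicalSpace N] [ChartedSpace HN N]
  {f g : M → N}

open Literature.Analysis.Calculus

/-- **Isotopy extension theorem for compact sources over an arbitrary model with corners,
from Whitney's extension theorem**: given `WhitneyExtensionConvex` (Whitney (1934), Thm. I with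
§3), smoothly isotopic smooth embeddings of a compact manifold `M` — any model with corners —
into a closed manifold `N` (compact, Hausdorff, without boundary points) are ambient isotopic:
the named fact `Literature.Topology.FourManifolds.isAmbientIsotopic_of_isSmoothlyIsotopic` of
`Isotopy.lean` in full generality (Hirsch (1976), Ch. 8 §1, Thm. 1.3, there for submanifolds
with boundary; unconditional cases `isAmbientIsotopic_of_isSmoothlyIsotopic_of_boundarylessManifold`,
`isAmbientIsotopic_of_isSmoothlyIsotopic_halfSpace`). [cite: HirschDT1976, Ch. 8 §1, Thm. 1.3] -/
theorem isAmbientIsotopic_of_isSmoothlyIsotopic_of_whitney (hW : WhitneyExtensionConvex) :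
    isAmbientIsotopic_of_isSmoothlyIsotopic (I := I) (J := J) (f := f) (g := g) := by
  intro _ _ _ _ _ _ hfg
  obtain ⟨F⟩ := hfg
  obtain ⟨Ψ, hΨ⟩ := F.exists_ambientIsotopy_comp_eq_of_whitney hW
  refine ⟨Ψ, funext fun x => ?_⟩
  have h := hΨ 1 ⟨by norm_num, by norm_num⟩ x
  rw [F.map_zero, F.map_one] at h
  exact h

/-- For embeddings of a compact manifold (any model with corners) into a closed manifold,
**smooth isotopy and ambient isotopy agree, given Whitney's extension theorem**: the named fact
`Literature.Topology.FourManifolds.isSmoothlyIsotopic_iff_isAmbientIsotopic` of `Isotopy.lean` in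
full generality from `WhitneyExtensionConvex` (Hirsch (1976), Ch. 8 §1, Thm. 1.3, with the
elementary converse `IsAmbientIsotopic.isSmoothlyIsotopic_holds`; unconditional cases
`isSmoothlyIsotopic_iff_isAmbientIsotopic_of_boundarylessManifold`,
`isSmoothlyIsotopic_iff_isAmbientIsotopic_halfSpace`). [cite: HirschDT1976, Ch. 8 §1, Thm. 1.3] -/
theorem isSmoothlyIsotopic_iff_isAmbientIsotopic_of_whitney (hW : WhitneyExtensionConvex) :
    isSmoothlyIsotopic_iff_isAmbientIsotopic (I := I) (J := J) (f := f) (g := g) := by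
  intro _ _ _ _ _ _ hf
  exact ⟨fun h => isAmbientIsotopic_of_isSmoothlyIsotopic_of_whitney hW h,
    fun h => IsAmbientIsotopic.isSmoothlyIsotopic_holds hf h⟩

end Facts

/-! ### Unconditional forms: Whitney's extension theorem is proved -/

section Holds

variable {EM HM EN HN : Type*} [NormedAddCommGroup EM] [NormedSpace ℝ EM] [TopologicalSpace HM]
  [NormedAddCommGroup EN] [NormedSpace ℝ EN] [TopologicalSpace HN]
  {I : ModelWithCorners ℝ EM HM} {J : ModelWithCorners ℝ EN HN}
  {M : Type*} [TopologicalSpace M] [ChartedSpace HM M]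
  {N : Type*} [TopologicalSpace N] [ChartedSpace HN N]
  {f g : M → N}

open Literature.Analysis.Calculus

/-- **Thm. 1.3 as printed, unconditionally**: a smooth isotopy `F` of a compact manifold `M`
(any model with corners) in a closed manifold `N` (compact, Hausdorff, without boundary points)
is covered by an ambient isotopy `Ψ` of `N`, `Ψ_t ∘ F_0 = F_t` for `-1/2 < t < 3/2`
(`exists_ambientIsotopy_comp_eq_of_whitney` with `WhitneyExtensionConvex_holds`).
[cite: HirschDT1976, Ch. 8 §1, Thm. 1.3] -/
theorem SmoothIsotopy.exists_ambientIsotopy_comp_eq_holds (F : SmoothIsotopy I J f g)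
    [IsManifold I ∞ M] [CompactSpace M] [IsManifold J ∞ N] [T2Space N] [CompactSpace N]
    [BoundarylessManifold J N] :
    ∃ Ψ : AmbientIsotopy J N, ∀ t ∈ Ioo (-1 / 2 : ℝ) (3 / 2), ∀ x,
      Ψ.toFun t (F.toFun 0 x) = F.toFun t x :=
  F.exists_ambientIsotopy_comp_eq_of_whitney WhitneyExtensionConvex_holds

/-- **Discharge** of the named fact
`Literature.Topology.FourManifolds.isAmbientIsotopic_of_isSmoothlyIsotopic` (`Isotopy.lean`) in
full generality (compact source over an arbitrary model with corners, closed target): smoothly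
isotopic smooth embeddings are ambient isotopic (Hirsch (1976), Ch. 8 §1, Thm. 1.3; the corners
of the source handled by Whitney's extension theorem, `WhitneyExtensionConvex_holds`).
[cite: HirschDT1976, Ch. 8 §1, Thm. 1.3] -/
theorem isAmbientIsotopic_of_isSmoothlyIsotopic_holds :
    isAmbientIsotopic_of_isSmoothlyIsotopic (I := I) (J := J) (f := f) (g := g) :=
  isAmbientIsotopic_of_isSmoothlyIsotopic_of_whitney WhitneyExtensionConvex_holds

/-- **Discharge** of the named fact
`Literature.Topology.FourManifolds.isSmoothlyIsotopic_iff_isAmbientIsotopic` (`Isotopy.lean`) in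
full generality: for embeddings of a compact manifold (any model with corners) into a closed
manifold, smooth isotopy and ambient isotopy agree (Hirsch (1976), Ch. 8 §1, Thm. 1.3 with the
elementary converse; corners via `WhitneyExtensionConvex_holds`).
[cite: HirschDT1976, Ch. 8 §1, Thm. 1.3] -/
theorem isSmoothlyIsotopic_iff_isAmbientIsotopic_holds :
    isSmoothlyIsotopic_iff_isAmbientIsotopic (I := I) (J := J) (f := f) (g := g) :=
  isSmoothlyIsotopic_iff_isAmbientIsotopic_of_whitney WhitneyExtensionConvex_holds

end Holds

end Literature.Topology.FourManifolds
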